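import Mathlib.Data.Nat.Choose.Sum
import Literature.Computability.MetaComplexity.SmolenskyProperty
import HarnessLib

/-!
# Smolensky's dimension bound: the usefulness mechanism of the `AC⁰[p]` natural property

Continuation of `SmolenskyProperty.lean` (groundwork for the named fact
`Literature.Computability.Learning.cikk_learn_AC0Mod`, CIKK 2016 Cor. 5.4, via CIKK Thm. 5.3).
The usefulness of Smolensky's property "`dim(f̄L + L) ≥ (3/4)2ⁿ`" against `AC⁰[p]` rests on two
printed ingredients: (i) the Razborov–Smolensky approximation — a small constant-depth circuit
with `MOD_p` gates agrees with a low-degree polynomial over `GF(p)` outside a small exceptional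
set `E` (Smolensky 1987, Lemmas 1–2; NOT in this file) — and (ii) Smolensky's dimension count
(Smolensky 1987, proof of Thm. 1, p. 80: "If we ignore the assignments where `g` differs from `f` …
we will get a smaller algebra … dimension … `2ⁿ⁻¹ + o(2ⁿ)`"), which this file proves in the
following exact form over any field `F`:

* `finrank_space_le`: if `f̄ = pmOf F h` agrees outside `E` with some `P ∈ lowDeg F n D`, then
  `dim(f̄L + L) ≤ Σ_{i ≤ n/2 + D} C(n,i) + |E|` (indeed `f̄L + L ⊆ lowDeg (n/2 + D) + F^E`,
  `F^E = suppOn F E` the functions supported on `E`);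
* `sum_range_choose_le`: for odd `n`, `Σ_{i ≤ n/2 + D} C(n,i) ≤ 2ⁿ⁻¹ + D · C(n, n/2)`;
* `not_mem_property`: hence, for odd `n`, `4 · (D · C(n,n/2) + |E|) < 2ⁿ` forces
  `h ∉ Smolensky.property F n` — the form in which usefulness against depth-`d` `AC⁰[p]` circuits
  of size `2^{Ω(n^{1/(2d)})}` follows from the approximation lemma with degree
  `D = O(n^{1/(2d)})^d ≪ √n` (CIKK Thm. 5.3; using `C(n,n/2) = O(2ⁿ/√n)`, not proved here);
* `finrank_space_le_of_bool_approx`: the same with the approximation stated for the `0/1`-valued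
  function (`f̄ = 1 - 2h` then agrees with `1 - 2P`).

## References

* R. Smolensky, *Algebraic methods in the theory of lower bounds for Boolean circuit
  complexity*, STOC 1987, 77–82, Thm. 1 and its proof (p. 80) [Smolensky1987].
* M. Carmosino, R. Impagliazzo, V. Kabanets, A. Kolokolova, *Learning algorithms from natural
  proofs*, CCC 2016, LIPIcs 50, Thm. 5.3, §5.2 [CarmosinoImpagliazzoKabanetsKolokolova2016].
-/

namespace Literature.Computability.MetaComplexity

open Finset Module

namespace Smolensky

variable {F : Type*} [Field F] {n : ℕ}

/-! ### Functions supported on a finite set -/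

/-- The indicator function `δ_e` of a point of the cube. [folklore] -/
def delta (F : Type*) [Field F] {n : ℕ} (e : Fin n → Bool) : CubeFn F n :=
  fun b => if b = e then 1 else 0

/-- The space `F^E` of functions supported on `E`: the span of the indicators `δ_e`, `e ∈ E`.
[folklore] -/
def suppOn (F : Type*) [Field F] {n : ℕ} (E : Finset (Fin n → Bool)) : Submodule F (CubeFn F n) :=
  Submodule.span F (Set.range fun e : {e // e ∈ E} => delta F e.1)

/-- A function vanishing outside `E` lies in `F^E` (it is `Σ_{e ∈ E} v(e) δ_e`). [folklore] -/
theorem mem_suppOn_of_forall {E : Finset (Fin n → Bool)} {v : CubeFn F n}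
    (hv : ∀ b, b ∉ E → v b = 0) : v ∈ suppOn F E := by
  have hrepr : v = ∑ e ∈ E, v e • delta F e := by
    funext b
    simp only [Finset.sum_apply, Pi.smul_apply, smul_eq_mul, delta, mul_ite, mul_one, mul_zero]
    rw [Finset.sum_ite_eq]
    by_cases hb : b ∈ E
    · rw [if_pos hb]
    · rw [if_neg hb, hv b hb]
  rw [hrepr]
  refine Submodule.sum_mem _ fun e he => Submodule.smul_mem _ _ (Submodule.subset_span ?_)
  exact ⟨⟨e, he⟩, rfl⟩

/-- `dim F^E ≤ |E|`. [folklore] -/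
theorem finrank_suppOn_le (E : Finset (Fin n → Bool)) :
    Module.finrank F (suppOn F E) ≤ E.card :=
  (finrank_range_le_card _).trans (Fintype.card_coe E).le

/-! ### The dimension of the degree filtration -/

/-- `dim lowDeg F n D ≤ Σ_{i ≤ D} C(n, i)` (the number of monomials of degree `≤ D`). [folklore] -/
theorem finrank_lowDeg_le (D : ℕ) :
    Module.finrank F (lowDeg F n D) ≤ ∑ i ∈ range (D + 1), n.choose i := by
  classical
  have h1 : Module.finrank F (lowDeg F n D) ≤ Fintype.card {S : Finset (Fin n) // S.card ≤ D} :=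
    finrank_range_le_card _
  refine h1.trans ?_
  rw [Fintype.card_subtype]
  have hsub : (univ.filter fun S : Finset (Fin n) => S.card ≤ D) ⊆
      (range (D + 1)).biUnion fun i => powersetCard i (univ : Finset (Fin n)) := by
    intro S hS
    simp only [Finset.mem_filter, Finset.mem_univ, true_and] at hS
    exact Finset.mem_biUnion.2 ⟨S.card, Finset.mem_range.2 (Nat.lt_succ_of_le hS),
      Finset.mem_powersetCard.2 ⟨Finset.subset_univ S, rfl⟩⟩
  refine (Finset.card_le_card hsub).trans (Finset.card_biUnion_le.trans ?_)
  refine Finset.sum_le_sum fun i _ => ?_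
  rw [Finset.card_powersetCard, Finset.card_univ, Fintype.card_fin]

/-- For odd `n`: `Σ_{i ≤ n/2 + D} C(n,i) ≤ 2ⁿ⁻¹ + D · C(n, n/2)` (the first `n/2 + 1` binomial
coefficients sum to `2ⁿ⁻¹`, the next `D` are each at most the middle one). [folklore] -/
theorem sum_range_choose_le (hn : Odd n) (D : ℕ) :
    ∑ i ∈ range (n / 2 + D + 1), n.choose i ≤ 2 ^ (n - 1) + D * n.choose (n / 2) := by
  obtain ⟨m, rfl⟩ := hn
  have hm : (2 * m + 1) / 2 = m := by omega
  rw [hm, ← Finset.sum_range_add_sum_Ico _ (show m + 1 ≤ m + D + 1 by omega),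
    Nat.sum_range_choose_halfway m]
  have h4 : 4 ^ m = 2 ^ (2 * m + 1 - 1) := by
    rw [show 2 * m + 1 - 1 = 2 * m by omega, pow_mul]
    norm_num
  rw [h4]
  refine Nat.add_le_add_left ?_ _
  calc ∑ i ∈ Ico (m + 1) (m + D + 1), (2 * m + 1).choose i
      ≤ ∑ _i ∈ Ico (m + 1) (m + D + 1), (2 * m + 1).choose m :=
        Finset.sum_le_sum fun i _ => by
          simpa [hm] using Nat.choose_le_middle i (2 * m + 1)
    _ = D * (2 * m + 1).choose m := by
        rw [Finset.sum_const, Nat.card_Ico, smul_eq_mul]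
        congr 1
        omega

/-! ### Smolensky's dimension bound -/

/-- **Smolensky's dimension bound** (the usefulness mechanism of CIKK Thm. 5.3): if the `±1`
version `f̄ = pmOf F h` of a Boolean function agrees outside a finite set `E` with a polynomial
function `P` of degree `≤ D`, then `f̄L + L ⊆ lowDeg (n/2 + D) + span{δ_e : e ∈ E}`, whence
`dim(f̄L + L) ≤ Σ_{i ≤ n/2 + D} C(n,i) + |E|`.
[cite: Smolensky1987, Thm. 1 (proof, p. 80)] -/
theorem finrank_space_le (h : (Fin n → Bool) → Bool) {D : ℕ} {P : CubeFn F n}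
    (hP : P ∈ lowDeg F n D) (E : Finset (Fin n → Bool)) (hE : ∀ b, b ∉ E → pmOf F h b = P b) :
    Module.finrank F (space F h) ≤ (∑ i ∈ range (n / 2 + D + 1), n.choose i) + E.card := by
  classical
  have hle : space F h ≤ lowDeg F n (n / 2 + D) ⊔ suppOn F E := by
    refine sup_le ?_ (le_sup_of_le_left (lowDeg_mono (Nat.le_add_right _ _)))
    rw [lowDeg_eq_span (D := n / 2), Submodule.map_span_le]
    rintro _ ⟨⟨S, hS⟩, rfl⟩
    dsimp only
    rw [LinearMap.mulLeft_apply]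
    have hsplit : pmOf F h * mono F S = P * mono F S + (pmOf F h - P) * mono F S := by
      rw [sub_mul, add_sub_cancel]
    rw [hsplit]
    refine Submodule.add_mem _ (Submodule.mem_sup_left ?_) (Submodule.mem_sup_right ?_)
    · have := mul_mem_lowDeg_add hP (mono_mem_lowDeg (F := F) hS)
      rwa [Nat.add_comm] at this
    · refine mem_suppOn_of_forall fun b hb => ?_
      rw [Pi.mul_apply, Pi.sub_apply, hE b hb, sub_self, zero_mul]
  refine (Submodule.finrank_mono hle).trans ?_
  refine (Submodule.finrank_add_le_finrank_add_finrank _ _).trans ?_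
  exact Nat.add_le_add (finrank_lowDeg_le _) (finrank_suppOn_le E)

/-- The same bound with the approximation stated for the `0/1`-valued function: if
`[h = 1]` agrees with `P ∈ lowDeg D` outside `E`, then `f̄ = 1 - 2h` agrees with `1 - 2P` there.
[cite: Smolensky1987, Thm. 1 (proof, p. 80)] -/
theorem finrank_space_le_of_bool_approx (h : (Fin n → Bool) → Bool) {D : ℕ} {P : CubeFn F n}
    (hP : P ∈ lowDeg F n D) (E : Finset (Fin n → Bool))
    (hE : ∀ b, b ∉ E → (if h b then (1 : F) else 0) = P b) :
    Module.finrank F (space F h) ≤ (∑ i ∈ range (n / 2 + D + 1), n.choose i) + E.card := by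
  refine finrank_space_le h (P := 1 - (2 : F) • P) ?_ E fun b hb => ?_
  · refine Submodule.sub_mem _ ?_ (Submodule.smul_mem _ _ hP)
    simpa using mono_mem_lowDeg (F := F) (S := (∅ : Finset (Fin n))) (Nat.zero_le D)
  · simp only [pmOf, Pi.sub_apply, Pi.one_apply, Pi.smul_apply, smul_eq_mul, ← hE b hb]
    split <;> norm_num

/-- **Usefulness criterion** (CIKK Thm. 5.3 mechanism, exact form): for odd `n`, if `f̄` agrees
outside `E` with a polynomial function of degree `≤ D` and `4 · (D · C(n, n/2) + |E|) < 2ⁿ`, then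
`h` does NOT have Smolensky's property (`dim(f̄L + L) < (3/4)2ⁿ`). With the Razborov–Smolensky
approximation (degree `D = ((p-1)ℓ)^d`, `|E| ≤ size · 2ⁿ/p^ℓ`) and `C(n,n/2) = O(2ⁿ/√n)` this is
usefulness against depth-`d` `AC⁰[p]` circuits of size `2^{Ω(n^{1/(2d)})}`.
[cite: CarmosinoImpagliazzoKabanetsKolokolova2016, Thm. 5.3] -/
theorem not_mem_property (hn : Odd n) (h : (Fin n → Bool) → Bool) {D : ℕ} {P : CubeFn F n}
    (hP : P ∈ lowDeg F n D) (E : Finset (Fin n → Bool)) (hE : ∀ b, b ∉ E → pmOf F h b = P b)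
    (hlt : 4 * (D * n.choose (n / 2) + E.card) < 2 ^ n) : h ∉ property F n := by
  rw [mem_property_iff, not_le]
  have h1 := finrank_space_le h hP E hE
  have h2 := sum_range_choose_le hn D
  have h3 : 2 ^ n = 2 * 2 ^ (n - 1) := by
    obtain ⟨m, rfl⟩ := hn
    rw [show 2 * m + 1 - 1 = 2 * m by omega, pow_succ]
    ring
  omega

end Smolensky

end Literature.Computability.MetaComplexity
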